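import Literature.Geometry.Riemannian.L2ToponogovInterpolation
import Literature.Geometry.Riemannian.ColdingSmoothedCosDist
import HarnessLib

/-!
# Colding's `L²`-Toponogov theorem for `cos d_p` (Colding 1996a, Prop. 1.15; *Aspects*, Thm. 1.1)

The distance comparison of Colding's Theorem 1.1 ("`‖d_t − d̲_t‖₂ < ε` for `0 ≤ t ≤ l` whenever
`d(p, q) > π − δ(ε, n)`"), in the derivative-free interpolation form used in §2 of
[Colding1996Shape] (cf. Hu–Yin, arXiv:1503.00889, Lemma 5.5 = [C, Lemma 2.10]): on the unit sphere
`sin ℓ · cos d_p(γ(t)) = sin(ℓ − t) cos d_p(γ(0)) + sin t · cos d_p(γ(ℓ))` along every unit speed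
geodesic; on a closed `n`-manifold with `Ric ≥ n − 1` and an almost antipodal pair `d(p, q) ≥ π − δ`
this identity almost holds for `cos d_p`, in `L¹` over the pairs `(x, y) ∈ M × M`, uniformly in
the intermediate point, along some minimal geodesic from `x` to `y`:

* **`lintegral_prod_iInf_iSup_abs_sin_mul_cos_edist_sub_le`** — with `V = Vol(M)`,
  `η = δ + (2nπ^{n−1}δ)^{1/n}`, `K = (4/τ² + 2n²) η² V` and any `τ > 0`,
  `∫∫ inf_γ sup_{s ∈ [0,1]} |sin d · cos d_p(γ(sd)) − sin((1−s)d) cos d_p(x) − sin(sd) cos d_p(y)|`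
  `  ≤ 2 (2cosh(π/2))^{n−1} π (2V) √(V (K + (n−1)√(K V))) + 3√(2nτ) V²`
  (`d = d(x, y)`); for `τ = η^{1/2}`, say, the right-hand side is `ψ(δ | n) V²`... explicitly.

Proof: the smoothed function `f = P_τ cos d_p` of `exists_smooth_approx_cos_riemannianEDist`
(`|f − cos d_p| ≤ √(2nτ)`, `∫ (Δf + nf)² ≤ K`, `∫ f² ≤ V`) satisfies the interpolation estimate
`lintegral_prod_iInf_iSup_abs_sin_mul_sub_le_of_contMDiffRiemannianMetric`, whose right-hand side
is monotone in `‖Δf + nf‖₂²` and `‖f‖₂²`; replacing `f` by `cos d_p` costs `3√(2nτ)` pointwise.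
Everything here is proved; no definitions, no named facts (D-0026).

## References

* T. H. Colding, *Shape of manifolds with positive Ricci curvature*, Invent. Math. 124 (1996)
  175–191, §1, Prop. 1.15; §2, Lemma 2.10. [Colding1996Shape]
* T. H. Colding, *Aspects of Ricci curvature*, in *Comparison Geometry* (1997), Thm. 1.1.
  [Colding1997Aspects]
-/

noncomputable section

open Bundle Set Function Filter MeasureTheory Manifold
open scoped Manifold ContDiff Topology ENNReal

namespace Literature.Geometry.Riemannian

open Lorentzian Lorentzian.PseudoRiemannianMetric
open Literature.Geometry.Lorentzian (riemannianMeasure)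

section FactVocabulary

/-- **Colding's `L²`-Toponogov theorem for `cos d_p`, interpolation form, in the binders of
`Colding1996_volume_ghClose`** (Colding 1996a, Prop. 1.15 / Lemma 2.10; *Aspects* Thm. 1.1).
On a closed connected Riemannian `n`-manifold `(M, h)`, `n ≥ 2`, with `Ric ≥ (n − 1) h`, let
`d(p, q) ≥ π − δ` with `0 ≤ δ < π/(2n)` and let `τ > 0`; put `V = μ_h(M)`,
`η = δ + (2nπ^{n−1}δ)^{1/n}`, `K = (4/τ² + 2n²) η² V`. Then
`∫_{M×M} inf_γ sup_{s ∈ [0,1]} |sin d · cos d_p(γ(s d)) − (sin((1−s)d) cos d_p(x) + sin(sd) cos d_p(y))|`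
`  ≤ 2 (2cosh(π/2))^{n−1} π (2V) √(V (K + (n − 1)√(K V))) + 3 √(2nτ) V²`,
`d = d(x, y)`, the infimum over the minimal unit-interval geodesics `γ_v`, `v ∈ T_xM`, from `x` to
`y`. [cite: Colding1996Shape, §1 Prop. 1.15, §2 Lemma 2.10] [cite: Colding1997Aspects, Thm. 1.1] -/
theorem lintegral_prod_iInf_iSup_abs_sin_mul_cos_edist_sub_le (n : ℕ) (hn : 2 ≤ n)
    (M : Type) [TopologicalSpace M] [T2Space M] [SecondCountableTopology M]
    [ChartedSpace (EuclideanSpace ℝ (Fin n)) M] [IsManifold (𝓡 n) ∞ M] [CompactSpace M]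
    [ConnectedSpace M] [MeasurableSpace M] [BorelSpace M]
    (h : Bundle.ContMDiffRiemannianMetric (𝓡 n) ∞ (EuclideanSpace ℝ (Fin n))
      (TangentSpace (𝓡 n) : M → Type _))
    [(PseudoRiemannianMetric.ofRiemannian h).HasLeviCivita]
    (hRic : ∀ (x : M) (v : TangentSpace (𝓡 n) x),
      ((n : ℝ) - 1) * h.inner x v v ≤ (PseudoRiemannianMetric.ofRiemannian h).ricci x v v)
    {p q : M} {δ : ℝ} (hδ : 0 ≤ δ) (hδn : δ < Real.pi / (2 * n))
    (hpq : ENNReal.ofReal (Real.pi - δ) ≤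
      (PseudoRiemannianMetric.ofRiemannian h).edist
        (PseudoRiemannianMetric.isRiemannian_ofRiemannian h) p q)
    {τ : ℝ} (hτ : 0 < τ) :
    ∫⁻ z, (⨅ v : {v : TangentSpace (𝓡 n) z.1 //
          IsMinimizingUpTo (PseudoRiemannianMetric.ofRiemannian h)
              (PseudoRiemannianMetric.isRiemannian_ofRiemannian h) z.1 v 1 ∧
            expMap (PseudoRiemannianMetric.ofRiemannian h).leviCivita z.1 v = z.2},
        ⨆ s : Icc (0:ℝ) 1,
          ENNReal.ofReal |Real.sin ((PseudoRiemannianMetric.ofRiemannian h).edist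
                (PseudoRiemannianMetric.isRiemannian_ofRiemannian h) z.1 z.2).toReal *
              Real.cos ((PseudoRiemannianMetric.ofRiemannian h).edist
                (PseudoRiemannianMetric.isRiemannian_ofRiemannian h) p
                (expMap (PseudoRiemannianMetric.ofRiemannian h).leviCivita z.1 ((s : ℝ) • v.1))).toReal -
            (Real.sin ((1 - s) * ((PseudoRiemannianMetric.ofRiemannian h).edist
                (PseudoRiemannianMetric.isRiemannian_ofRiemannian h) z.1 z.2).toReal) *
                Real.cos ((PseudoRiemannianMetric.ofRiemannian h).edist
                  (PseudoRiemannianMetric.isRiemannian_ofRiemannian h) p z.1).toReal +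
              Real.sin (s * ((PseudoRiemannianMetric.ofRiemannian h).edist
                (PseudoRiemannianMetric.isRiemannian_ofRiemannian h) z.1 z.2).toReal) *
                Real.cos ((PseudoRiemannianMetric.ofRiemannian h).edist
                  (PseudoRiemannianMetric.isRiemannian_ofRiemannian h) p z.2).toReal)|)
        ∂((riemannianMeasure h).prod (riemannianMeasure h)) ≤
      2 * ENNReal.ofReal ((2 * Real.cosh (Real.pi / 2)) ^ (n - 1) * Real.pi *
          (2 * (riemannianMeasure h univ).toReal) *
          Real.sqrt ((riemannianMeasure h univ).toReal *
            ((4 / τ ^ 2 + 2 * (n : ℝ) ^ 2) *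
                (δ + (2 * n * Real.pi ^ (n - 1) * δ) ^ ((n : ℝ)⁻¹)) ^ 2 *
                (riemannianMeasure h univ).toReal +
              ((n : ℝ) - 1) * Real.sqrt
                ((4 / τ ^ 2 + 2 * (n : ℝ) ^ 2) *
                    (δ + (2 * n * Real.pi ^ (n - 1) * δ) ^ ((n : ℝ)⁻¹)) ^ 2 *
                    (riemannianMeasure h univ).toReal * (riemannianMeasure h univ).toReal)))) +
        ENNReal.ofReal (3 * Real.sqrt (2 * n * τ)) * (riemannianMeasure h univ) ^ 2 := by
  set g := PseudoRiemannianMetric.ofRiemannian h with hg_def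
  set hg : g.IsRiemannian := PseudoRiemannianMetric.isRiemannian_ofRiemannian h with hg'
  have hvol : g.riemVolume = riemannianMeasure h := PseudoRiemannianMetric.riemVolume_eq hg
  haveI : IsFiniteMeasure (riemannianMeasure h) := by
    rw [← hvol]; exact ⟨g.riemVolume_univ_lt_top⟩
  set V : ℝ := (riemannianMeasure h univ).toReal with hV
  set ρ : ℝ := Real.sqrt (2 * n * τ) with hρ
  set K : ℝ := (4 / τ ^ 2 + 2 * (n : ℝ) ^ 2) *
    (δ + (2 * n * Real.pi ^ (n - 1) * δ) ^ ((n : ℝ)⁻¹)) ^ 2 * V with hK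
  -- the smoothed function
  obtain ⟨f, hf, h1, h2, -, h4, -⟩ :=
    exists_smooth_approx_cos_riemannianEDist n hn M h hRic hδ hδn hpq hτ
  have h2' : ∀ x, |f x - Real.cos (g.edist hg p x).toReal| ≤ ρ := h2
  set A : ℝ := ∫ x, (g.dalembertian f x + n * f x) ^ 2 ∂riemannianMeasure h with hA
  set B : ℝ := ∫ x, f x ^ 2 ∂riemannianMeasure h with hB
  have hA0 : 0 ≤ A := integral_nonneg fun x ↦ sq_nonneg _
  have hB0 : 0 ≤ B := integral_nonneg fun x ↦ sq_nonneg _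
  have hV0 : 0 ≤ V := ENNReal.toReal_nonneg
  have hAK : A ≤ K := h4
  have hBV : B ≤ V := by
    have h1' : ∫ x, f x ^ 2 ∂riemannianMeasure h ≤ ∫ _, (1 : ℝ) ∂riemannianMeasure h := by
      refine integral_mono_of_nonneg (Eventually.of_forall fun x ↦ sq_nonneg _)
        (integrable_const _) (Eventually.of_forall fun x ↦ ?_)
      have := sq_le_sq' (abs_le.1 (h1 x)).1 (abs_le.1 (h1 x)).2
      simpa using this
    rwa [integral_const, smul_eq_mul, mul_one, measureReal_def] at h1'
  have hn1 : (0 : ℝ) ≤ (n : ℝ) - 1 := by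
    have : (2 : ℝ) ≤ n := by exact_mod_cast hn
    linarith
  -- the interpolation estimate for `f`, with its right-hand side bounded by the one for `K, V`
  have h16 := lintegral_prod_iInf_iSup_abs_sin_mul_sub_le_of_contMDiffRiemannianMetric n hn M h
    hRic hf
  have hmono : Real.sqrt (V * (A + ((n : ℝ) - 1) * Real.sqrt (A * B))) ≤
      Real.sqrt (V * (K + ((n : ℝ) - 1) * Real.sqrt (K * V))) := by
    refine Real.sqrt_le_sqrt (mul_le_mul_of_nonneg_left ?_ hV0)
    have hsq : Real.sqrt (A * B) ≤ Real.sqrt (K * V) :=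
      Real.sqrt_le_sqrt (mul_le_mul hAK hBV hB0 (hA0.trans hAK))
    nlinarith
  have hC0 : 0 ≤ (2 * Real.cosh (Real.pi / 2)) ^ (n - 1) * Real.pi * (2 * V) := by positivity
  have h16' := h16.trans (mul_le_mul_right (ENNReal.ofReal_le_ofReal
    (mul_le_mul_of_nonneg_left hmono hC0)) 2)
  -- pointwise replacement of `f` by `cos d_p`
  have hρ0 : 0 ≤ ρ := Real.sqrt_nonneg _
  have hpt : ∀ (x y w : M) (a b c : ℝ), |a| ≤ 1 → |b| ≤ 1 → |c| ≤ 1 →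
      |a * Real.cos (g.edist hg p w).toReal -
          (b * Real.cos (g.edist hg p x).toReal + c * Real.cos (g.edist hg p y).toReal)| ≤
        |a * f w - (b * f x + c * f y)| + 3 * ρ := by
    intro x y w a b c ha hb hc
    have ew := h2' w
    have ex := h2' x
    have ey := h2' y
    have key : |a * Real.cos (g.edist hg p w).toReal -
          (b * Real.cos (g.edist hg p x).toReal + c * Real.cos (g.edist hg p y).toReal) -
        (a * f w - (b * f x + c * f y))| ≤ 3 * ρ := by
      have e1 : a * Real.cos (g.edist hg p w).toReal -
          (b * Real.cos (g.edist hg p x).toReal + c * Real.cos (g.edist hg p y).toReal) -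
          (a * f w - (b * f x + c * f y)) =
          -(a * (f w - Real.cos (g.edist hg p w).toReal)) +
            b * (f x - Real.cos (g.edist hg p x).toReal) +
            c * (f y - Real.cos (g.edist hg p y).toReal) := by ring
      rw [e1]
      refine (abs_add_three _ _ _).trans ?_
      rw [abs_neg, abs_mul, abs_mul, abs_mul]
      have i1 : |a| * |f w - Real.cos (g.edist hg p w).toReal| ≤ 1 * ρ :=
        mul_le_mul ha ew (abs_nonneg _) zero_le_one
      have i2 : |b| * |f x - Real.cos (g.edist hg p x).toReal| ≤ 1 * ρ :=
        mul_le_mul hb ex (abs_nonneg _) zero_le_one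
      have i3 : |c| * |f y - Real.cos (g.edist hg p y).toReal| ≤ 1 * ρ :=
        mul_le_mul hc ey (abs_nonneg _) zero_le_one
      linarith
    have := abs_sub_abs_le_abs_sub
      (a * Real.cos (g.edist hg p w).toReal -
        (b * Real.cos (g.edist hg p x).toReal + c * Real.cos (g.edist hg p y).toReal))
      (a * f w - (b * f x + c * f y))
    linarith
  -- integrate
  have hmeasU : ((riemannianMeasure h).prod (riemannianMeasure h)) univ =
      riemannianMeasure h univ ^ 2 := by
    rw [← univ_prod_univ, Measure.prod_prod, sq]
  calc _ ≤ ∫⁻ z, ((⨅ v : {v : TangentSpace (𝓡 n) z.1 //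
            IsMinimizingUpTo g hg z.1 v 1 ∧ expMap g.leviCivita z.1 v = z.2},
          ⨆ s : Icc (0:ℝ) 1,
            ENNReal.ofReal |Real.sin (g.edist hg z.1 z.2).toReal *
                f (expMap g.leviCivita z.1 ((s : ℝ) • v.1)) -
              (Real.sin ((1 - s) * (g.edist hg z.1 z.2).toReal) * f z.1 +
                Real.sin (s * (g.edist hg z.1 z.2).toReal) * f z.2)|) +
          ENNReal.ofReal (3 * ρ)) ∂((riemannianMeasure h).prod (riemannianMeasure h)) := by
        refine lintegral_mono fun z ↦ ?_
        rw [ENNReal.iInf_add]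
        refine iInf_mono fun v ↦ ?_
        rw [ENNReal.iSup_add]
        refine iSup_mono fun s ↦ ?_
        rw [← ENNReal.ofReal_add (abs_nonneg _) (by positivity)]
        exact ENNReal.ofReal_le_ofReal (hpt z.1 z.2 _ _ _ _ (Real.abs_sin_le_one _)
          (Real.abs_sin_le_one _) (Real.abs_sin_le_one _))
    _ = _ + ENNReal.ofReal (3 * ρ) * riemannianMeasure h univ ^ 2 := by
        rw [lintegral_add_right _ measurable_const, lintegral_const, hmeasU]
    _ ≤ _ := add_le_add h16' le_rfl

end FactVocabulary

end Literature.Geometry.Riemannian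

end
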